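import Mathlib
import Summits.Ventures.LatticeQCDFlow.TrivializingMaps.WitnessColumnRP
import Summits.Ventures.LatticeQCDFlow.TrivializingMaps.PlaquetteHaarMoments
import Literature.MathematicalPhysics.QuantumFieldTheory.ConstructiveQFTWave0Proofs
import HarnessLib

/-!
# The four-staple word of a plaquette (support of THEOREM P, `WitnessNearestNeighbour`)

HONEST FRAMING: exact (Metropolis-corrected) sampling algorithms for lattice gauge theory; figures of
merit are autocorrelation/cost numbers at stated couplings and volumes; no continuum-physics claim.

The algebra and the bookkeeping behind THEOREM P (`c₁ = K(1) > 0`, (O3) of THEORY-1), separated out so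
that the analytic file stays short. Setting of `WitnessColumnRP` / Wave 0 (`ConstructiveQFTWave0Proofs`):
torus `(ZMod L)^d`, time direction `0`, link reflection between the slices `0 | 1`; the
Osterwalder–Seiler letters `WilsonRP.coeff ρ hρ β (q, k, l, b)` are `√(β/2)` times the `(k,l)` entry
(`b = true`) or its conjugate (`b = false`) of the unitarised (`CompactGroup.unitarize`) HALF
PLAQUETTE = lower STAPLE `ω_q = V_y V_{(y+e₀, k)} V_{y+e_k}⁻¹` of a crossing plaquette `q = (y; 0, k)`,
`y₀ = 0`.
* §1 `stapleWord x i j` — for a slice-`0` site `x` and spatial directions `0 < i, j` the word of the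
  four letters on the staples of `(x;0,i)`, `(x+eᵢ;0,j)` [entries] and `(x+eⱼ;0,i)`, `(x;0,j)`
  [conjugate entries]; `halfPlaq_staples`: `ω₁ ω₂ ω₃⁻¹ ω₄⁻¹ = V_x · U_{(x+e₀; i, j)} · V_x⁻¹` (the
  temporal links telescope), hence `trace_hol_eq_sum_staples` (`tr σ(U_{p₁})` as a sum over `N⁴`
  index tuples of products of staple entries) and `sum_prod_coeff_stapleWord`:
  `Σ_ω ∏ₜ coeff (stapleWord ω t) V = (β/2)² · tr ρ(U_{(x+e₀;i,j)})`.
* §2 `timeTranslate_one_plaqRe`: the slice-`1` translate of the plaquette observable `Re tr ρ(U_p)`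
  is the time-neighbour plaquette `Re tr ρ(U_{p+e₀})` (that a slice-`0` spatial plaquette is a
  slice-`0` observable is the tree's `dependsOn_plaqRe_slice`, `WitnessColumnPlaquette`).
* §3 `haarSqReTrace_le_Q` [lattice `SU(n)`, `n ≥ 2`, `L ≥ 2`]: under Haar^E a plaquette is Haar
  distributed (tree `integral_comp_plaquetteHolonomy_eq_haar`) and `∫ Re tr = 0`, so
  `m₂(n) = ∫_{SU(n)} (Re tr)² ≤ ∫ (Re tr U_q - c)² dHaar^E` for every real `c`.

NOT CLAIMED: anything about the Wilson measure (pure algebra / Haar facts). References: K. Osterwalder,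
E. Seiler, Ann. Phys. 110 (1978) 440 §2 (the letters); M. Creutz, *Quarks, gluons and lattices* (1983)
ch. 9 (staples).
-/

noncomputable section

namespace Summit.Ventures.LatticeQCDFlow.TrivializingMaps

open MeasureTheory Finset
open scoped ComplexOrder ComplexConjugate

namespace WitnessColumn

open Literature.MathematicalPhysics.QuantumFieldTheory
open Literature.RepresentationTheory.CompactGroups

section General

variable {d L : ℕ} [NeZero d] [NeZero L] {G : Type*} [Group G] [TopologicalSpace G]
  [IsTopologicalGroup G] [CompactSpace G] [MeasurableSpace G] [BorelSpace G] {N : ℕ}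
  (ρ : G →* Matrix (Fin N) (Fin N) ℂ)

/-! ## §1. The four-staple word -/

/-- The four-staple word `w(ω)`, `ω = (k, n', m, l)`: the letters
`(q₁,k,l,+), (q₂,l,m,+), (q₃,n',m,-), (q₄,k,n',-)` on the four temporal plaquettes
`q₁ = (x;0,i)`, `q₂ = (x+eᵢ;0,j)`, `q₃ = (x+eⱼ;0,i)`, `q₄ = (x;0,j)` bounding the time-neighbour of
the spatial plaquette `(x;i,j)` from below. -/
def stapleWord (x : Site d L) (i j : Fin d) (hi : 0 < i) (hj : 0 < j)
    (ω : Fin N × Fin N × Fin N × Fin N) : Fin 4 → WilsonRP.CoeffIndex d L N :=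
  ![((x, ⟨(0, i), hi⟩), ω.1, ω.2.2.2, true), ((x.shift i, ⟨(0, j), hj⟩), ω.2.2.2, ω.2.2.1, true),
    ((x.shift j, ⟨(0, i), hi⟩), ω.2.1, ω.2.2.1, false), ((x, ⟨(0, j), hj⟩), ω.1, ω.2.1, false)]

omit [NeZero L] [TopologicalSpace G] [IsTopologicalGroup G] [CompactSpace G] [MeasurableSpace G]
  [BorelSpace G] in
/-- **The four staples multiply to a conjugate of the plaquette one step up in time**:
`ω_{q₁} ω_{q₂} ω_{q₃}⁻¹ ω_{q₄}⁻¹ = V_{(x,0)} · U_{(x+e₀; i,j)} · V_{(x,0)}⁻¹` (`x₀ = 0`). -/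
theorem halfPlaq_staples (x : Site d L) (h0 : x 0 = 0) {i j : Fin d} (hi : 0 < i) (hj : 0 < j)
    (V : GaugeConfig d L G) :
    WilsonRP.halfPlaq (x, ⟨(0, i), hi⟩) V * WilsonRP.halfPlaq (x.shift i, ⟨(0, j), hj⟩) V
        * (WilsonRP.halfPlaq (x.shift j, ⟨(0, i), hi⟩) V)⁻¹ * (WilsonRP.halfPlaq (x, ⟨(0, j), hj⟩) V)⁻¹
      = V (x, 0) * plaquetteHolonomy V (x.shift 0) i j * (V (x, 0))⁻¹ := by
  have hxi : (x.shift i) 0 = 0 := by rw [WilsonRP.shift_apply_of_ne x hi.ne, h0]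
  have hxj : (x.shift j) 0 = 0 := by rw [WilsonRP.shift_apply_of_ne x hj.ne, h0]
  simp only [WilsonRP.halfPlaq, h0, hxi, hxj, ZMod.val_zero, if_true]
  rw [WilsonRP.shift_comm x i 0, WilsonRP.shift_comm x j 0, WilsonRP.shift_comm x j i]
  simp only [plaquetteHolonomy, mul_inv_rev, inv_inv, mul_assoc, inv_mul_cancel_left]

omit [NeZero L] [MeasurableSpace G] [BorelSpace G] in
/-- **`tr ρ(U_{p₁})` as a sum over the four-staple Gram words**: with `σ` the unitarisation of `ρ`,
`tr ρ(U_{(x+e₀;i,j)}) = Σ_{k,n',m,l} σ(ω₁)_{kl} σ(ω₂)_{lm} conj σ(ω₃)_{n'm} conj σ(ω₄)_{kn'}`. -/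
theorem trace_hol_eq_sum_staples (hρ : Continuous ρ) (x : Site d L) (h0 : x 0 = 0) {i j : Fin d}
    (hi : 0 < i) (hj : 0 < j) (V : GaugeConfig d L G) :
    (ρ (plaquetteHolonomy V (x.shift 0) i j)).trace
      = ∑ ω : Fin N × Fin N × Fin N × Fin N,
          CompactGroup.unitarize ρ hρ (WilsonRP.halfPlaq (x, ⟨(0, i), hi⟩) V) ω.1 ω.2.2.2
          * CompactGroup.unitarize ρ hρ (WilsonRP.halfPlaq (x.shift i, ⟨(0, j), hj⟩) V) ω.2.2.2 ω.2.2.1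
          * conj (CompactGroup.unitarize ρ hρ (WilsonRP.halfPlaq (x.shift j, ⟨(0, i), hi⟩) V) ω.2.1 ω.2.2.1)
          * conj (CompactGroup.unitarize ρ hρ (WilsonRP.halfPlaq (x, ⟨(0, j), hj⟩) V) ω.1 ω.2.1) := by
  rw [← CompactGroup.trace_unitarize ρ hρ,
    ← CompactGroup.trace_conj_eq (CompactGroup.unitarize ρ hρ) _ (V (x, 0)),
    ← halfPlaq_staples x h0 hi hj V, map_mul, map_mul, map_mul, CompactGroup.unitarize_inv,
    CompactGroup.unitarize_inv, Matrix.star_eq_conjTranspose, Matrix.star_eq_conjTranspose]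
  simp only [Matrix.trace, Matrix.diag_apply, Matrix.mul_apply, Matrix.conjTranspose_apply,
    starRingEnd_apply, Finset.sum_mul, Fintype.sum_prod_type]

omit [NeZero L] [MeasurableSpace G] [BorelSpace G] in
/-- The letters of a four-staple word multiply to `(β/2)²`× the corresponding Gram monomial. -/
theorem prod_coeff_stapleWord (hρ : Continuous ρ) {β : ℝ} (hβ : 0 ≤ β) (x : Site d L) (h0 : x 0 = 0)
    {i j : Fin d} (hi : 0 < i) (hj : 0 < j) (ω : Fin N × Fin N × Fin N × Fin N)
    (V : GaugeConfig d L G) :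
    ∏ t, WilsonRP.coeff ρ hρ β (stapleWord x i j hi hj ω t) V
      = (((β / 2) ^ 2 : ℝ) : ℂ) *
        (CompactGroup.unitarize ρ hρ (WilsonRP.halfPlaq (x, ⟨(0, i), hi⟩) V) ω.1 ω.2.2.2
          * CompactGroup.unitarize ρ hρ (WilsonRP.halfPlaq (x.shift i, ⟨(0, j), hj⟩) V) ω.2.2.2 ω.2.2.1
          * conj (CompactGroup.unitarize ρ hρ (WilsonRP.halfPlaq (x.shift j, ⟨(0, i), hi⟩) V) ω.2.1 ω.2.2.1)
          * conj (CompactGroup.unitarize ρ hρ (WilsonRP.halfPlaq (x, ⟨(0, j), hj⟩) V) ω.1 ω.2.1)) := by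
  have hxi : (x.shift i) 0 = 0 := by rw [WilsonRP.shift_apply_of_ne x hi.ne, h0]
  have hxj : (x.shift j) 0 = 0 := by rw [WilsonRP.shift_apply_of_ne x hj.ne, h0]
  have h1 : WilsonRP.IsCrossPlaq ((x, ⟨(0, i), hi⟩) : Plaquette d L) :=
    ⟨rfl, Or.inl (by simp [h0])⟩
  have h2 : WilsonRP.IsCrossPlaq ((x.shift i, ⟨(0, j), hj⟩) : Plaquette d L) :=
    ⟨rfl, Or.inl (by simp [hxi])⟩
  have h3 : WilsonRP.IsCrossPlaq ((x.shift j, ⟨(0, i), hi⟩) : Plaquette d L) :=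
    ⟨rfl, Or.inl (by simp [hxj])⟩
  have h4 : WilsonRP.IsCrossPlaq ((x, ⟨(0, j), hj⟩) : Plaquette d L) :=
    ⟨rfl, Or.inl (by simp [h0])⟩
  have hs : ((Real.sqrt (β / 2) : ℝ) : ℂ) ^ 4 = (((β / 2) ^ 2 : ℝ) : ℂ) := by
    rw [show (4 : ℕ) = 2 * 2 from rfl, pow_mul, ← Complex.ofReal_pow, Real.sq_sqrt (by positivity),
      Complex.ofReal_pow]
  simp only [Fin.prod_univ_four, stapleWord, Matrix.cons_val, WilsonRP.coeff,
    if_pos h1, if_pos h2, if_pos h3, if_pos h4, if_true, Bool.false_eq_true, if_false]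
  rw [← hs]
  ring

omit [NeZero L] [MeasurableSpace G] [BorelSpace G] in
/-- **`(β/2)² tr ρ(U_{p₁}) = Σ_ω ∏ₜ a_{w(ω)ₜ}`**: the plaquette character one step up in time is
a sum of four-staple word monomials in the Osterwalder–Seiler letters. -/
theorem sum_prod_coeff_stapleWord (hρ : Continuous ρ) {β : ℝ} (hβ : 0 ≤ β) (x : Site d L)
    (h0 : x 0 = 0) {i j : Fin d} (hi : 0 < i) (hj : 0 < j) (V : GaugeConfig d L G) :
    ∑ ω : Fin N × Fin N × Fin N × Fin N, ∏ t, WilsonRP.coeff ρ hρ β (stapleWord x i j hi hj ω t) V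
      = (((β / 2) ^ 2 : ℝ) : ℂ) * (ρ (plaquetteHolonomy V (x.shift 0) i j)).trace := by
  rw [trace_hol_eq_sum_staples ρ hρ x h0 hi hj V, Finset.mul_sum]
  exact Finset.sum_congr rfl fun ω _ => prod_coeff_stapleWord ρ hρ hβ x h0 hi hj ω V

/-! ## §2. The time-neighbour of the plaquette witness -/

omit [NeZero L] [TopologicalSpace G] [IsTopologicalGroup G] [CompactSpace G] [BorelSpace G] in
/-- **The time-neighbour.** The slice-`1` copy of `Re tr ρ(U_{(x;i,j)})` is `Re tr ρ(U_{(x+e₀;i,j)})`. -/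
theorem timeTranslate_one_plaqRe (p : Plaquette d L) (V : GaugeConfig d L G) :
    timeTranslate (1 : ZMod L) (fun U : GaugeConfig d L G => WilsonRP.plaqRe ρ U p) V
      = (ρ (plaquetteHolonomy V (p.1.shift 0) p.2.1.1 p.2.1.2)).trace.re := by
  have e1 : ∀ (y : Site d L) (k : Fin d),
      y.shift k + Pi.single (0 : Fin d) (1 : ZMod L) = (y + Pi.single (0 : Fin d) (1 : ZMod L)).shift k :=
    fun y k => add_right_comm _ _ _
  unfold timeTranslate WilsonRP.plaqRe plaquetteHolonomy
  rw [Function.comp_apply, torusConfigShift_neg_apply, torusConfigShift_neg_apply,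
    torusConfigShift_neg_apply, torusConfigShift_neg_apply, e1, e1]
  rfl
end General

/-! ## §3. Lattice `SU(n)`: the Haar floor of `Q` -/

section SUn

open Matrix

variable {d L n : ℕ} [NeZero d] [NeZero L]

omit [NeZero d] in
/-- `Q ≥ m₂(n)`: under Haar^E the time-neighbour plaquette is Haar distributed
(`integral_comp_plaquetteHolonomy_eq_haar`) and `∫_{SU(n)} Re tr = 0` (`n ≥ 2`), so
`∫ (Re tr U_{p₁} - c)² dHaar^E = m₂(n) + c² ≥ m₂(n)`. -/
theorem haarSqReTrace_le_Q (hL : 2 ≤ L) (hn : 2 ≤ n) (y : Site d L) {i j : Fin d} (hij : i ≠ j)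
    (c : ℝ) :
    ∫ g, ((g : Matrix (Fin n) (Fin n) ℂ)).trace.re ^ 2 ∂(haarProbability (specialUnitaryGroup (Fin n) ℂ))
      ≤ ∫ U, ((((plaquetteHolonomy U y i j : specialUnitaryGroup (Fin n) ℂ) :
            Matrix (Fin n) (Fin n) ℂ)).trace.re - c) ^ 2
          ∂(Measure.pi fun _ : Edge d L => haarProbability (specialUnitaryGroup (Fin n) ℂ)) := by
  haveI : SecondCountableTopology (Matrix (Fin n) (Fin n) ℂ) :=
    inferInstanceAs (SecondCountableTopology (Fin n → Fin n → ℂ))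
  haveI : SecondCountableTopology (specialUnitaryGroup (Fin n) ℂ) :=
    Topology.IsEmbedding.subtypeVal.secondCountableTopology
  have hf : Continuous fun g : specialUnitaryGroup (Fin n) ℂ => ((g : Matrix (Fin n) (Fin n) ℂ)).trace.re :=
    Complex.continuous_re.comp continuous_subtype_val.matrix_trace
  have hφ : Continuous fun g : specialUnitaryGroup (Fin n) ℂ =>
      (((g : Matrix (Fin n) (Fin n) ℂ)).trace.re - c) ^ 2 := (hf.sub continuous_const).pow 2
  have hlaw := integral_comp_plaquetteHolonomy_eq_haar (n := n) hL y hij hφ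
  rw [Luscher2010.trivialMeasure] at hlaw
  rw [hlaw]
  have hi1 : Integrable (fun g : specialUnitaryGroup (Fin n) ℂ =>
      ((g : Matrix (Fin n) (Fin n) ℂ)).trace.re ^ 2) (haarProbability (specialUnitaryGroup (Fin n) ℂ)) :=
    (BoundedContinuousFunction.mkOfCompact ⟨_, hf.pow 2⟩).integrable _
  have hi2 : Integrable (fun g : specialUnitaryGroup (Fin n) ℂ =>
      ((g : Matrix (Fin n) (Fin n) ℂ)).trace.re) (haarProbability (specialUnitaryGroup (Fin n) ℂ)) :=
    (BoundedContinuousFunction.mkOfCompact ⟨_, hf⟩).integrable _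
  have hexp : ∫ g, (((g : Matrix (Fin n) (Fin n) ℂ)).trace.re - c) ^ 2 ∂(haarProbability (specialUnitaryGroup (Fin n) ℂ))
      = ∫ g, ((g : Matrix (Fin n) (Fin n) ℂ)).trace.re ^ 2 ∂(haarProbability (specialUnitaryGroup (Fin n) ℂ))
        - 2 * c * ∫ g, ((g : Matrix (Fin n) (Fin n) ℂ)).trace.re ∂(haarProbability (specialUnitaryGroup (Fin n) ℂ)) + c ^ 2 := by
    have hpt : ∀ g : specialUnitaryGroup (Fin n) ℂ, (((g : Matrix (Fin n) (Fin n) ℂ)).trace.re - c) ^ 2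
        = ((g : Matrix (Fin n) (Fin n) ℂ)).trace.re ^ 2
          - 2 * c * ((g : Matrix (Fin n) (Fin n) ℂ)).trace.re + c ^ 2 := fun g => by ring
    simp_rw [hpt]
    have hA : Integrable (fun g : specialUnitaryGroup (Fin n) ℂ =>
        ((g : Matrix (Fin n) (Fin n) ℂ)).trace.re ^ 2 - 2 * c * ((g : Matrix (Fin n) (Fin n) ℂ)).trace.re)
        (haarProbability (specialUnitaryGroup (Fin n) ℂ)) :=
      hi1.sub (hi2.const_mul _)
    have hB : Integrable (fun g : specialUnitaryGroup (Fin n) ℂ =>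
        2 * c * ((g : Matrix (Fin n) (Fin n) ℂ)).trace.re) (haarProbability (specialUnitaryGroup (Fin n) ℂ)) := hi2.const_mul _
    rw [integral_add hA (integrable_const _), integral_sub hi1 hB, integral_const_mul, integral_const,
      smul_eq_mul, probReal_univ, one_mul]
  rw [hexp, integral_re_trace_haar_eq_zero hn, mul_zero, sub_zero]
  nlinarith [sq_nonneg c]

end SUn

end WitnessColumn

end Summit.Ventures.LatticeQCDFlow.TrivializingMaps

end
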